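import Summits.Ventures.PercRepro.S1SpreadTriDegree

/-!
# PercRepro — THE NULLITY BUDGET OF A CIRCUIT AGAINST THE TRIANGLES: THE BASE LEMMAS OF THE SLACK-ZERO STRUCTURE
THEOREM (p1, gen 36)

`proofs/P1-S2-CORANK6.md` §4u. On a spread e-free core of nullity `d` with `t = d` triangles (every unit of nullity is spent on
a triangle), a circuit `C` of size `4` is the symmetric difference of two triangles sharing a point (the main module). The
bookkeeping is the NULLITY BUDGET: writing `rk X := (M.eRk X).toNat`,
* **`nullity_step`**: adding a circuit `T ⊄ U` to `U` raises the nullity `|·| − rk` by at least one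
  (`U.ncard + rk (U ∪ T) + 1 ≤ (U ∪ T).ncard + rk U`);
* **`eRk_union_biUnion_add_card_le`**: a finite family of circuits each with a private point outside a base set `U` raises
  the nullity of `U` by at least its size (the relative form of `eRk_add_card_le_ncard_biUnion`);
* **`ncard_le_eRk_toNat_add_of_subset`**: the nullity of a subset is at most the nullity `d` of the ground set;
* **`ncard_union_filter_le_eRk_add_card`** (THE BUDGET): with `d` circuits carrying pairwise private points (a choice `priv`),
  for every `C ⊆ E` the set `C ∪ ⋃ {T : priv T ∈ C}` has nullity at most `#{T : priv T ∈ C}` — the `d − #{…}` other private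
  points lie outside it and each costs a unit of the budget `d`.
Geometric exclusions used by the case analysis: **`six_of_three_triangles`** (three triangles pairwise sharing distinct points
span a six-point set of rank `≤ 3`, impossible in regime B). Nothing about any cell is claimed. Axioms: standard.
-/

open scoped Matroid

namespace PercRepro

namespace S1

open Set

variable {α : Type}

/-- **A circuit not inside `U` adds at most `|T ∖ U| − 1` to the rank**: `rk (U ∪ T) + 1 ≤ rk U + |T ∖ U|`. -/
theorem eRk_union_circuit_add_one_le (M : Matroid α) {U T : Set α} (hU : U ⊆ M.E) (hT : M.IsCircuit T)
    (hnot : ¬ T ⊆ U) : M.eRk (U ∪ T) + 1 ≤ M.eRk U + (T \ U).encard := by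
  obtain ⟨p, hpT, hpU⟩ : ∃ p ∈ T, p ∉ U := by
    by_contra h
    push Not at h
    exact hnot h
  have hcl : U ∪ T ⊆ M.closure (U ∪ ((T \ {p}) \ U)) := by
    intro t ht
    have hsub : U ∪ ((T \ {p}) \ U) ⊆ M.E :=
      union_subset hU ((sdiff_subset.trans sdiff_subset).trans hT.subset_ground)
    rcases ht with ht | ht
    · exact M.subset_closure _ hsub (Or.inl ht)
    · by_cases htp : t = p
      · subst htp
        have h1 : T \ {t} ⊆ U ∪ ((T \ {t}) \ U) := by
          intro u hu
          by_cases huU : u ∈ U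
          · exact Or.inl huU
          · exact Or.inr ⟨hu, huU⟩
        exact M.closure_subset_closure h1 (hT.mem_closure_sdiff_singleton_of_mem hpT)
      · by_cases htU : t ∈ U
        · exact M.subset_closure _ hsub (Or.inl htU)
        · exact M.subset_closure _ hsub (Or.inr ⟨⟨ht, fun h => htp (mem_singleton_iff.1 h)⟩, htU⟩)
  have h1 : M.eRk (U ∪ T) ≤ M.eRk (U ∪ ((T \ {p}) \ U)) := by
    have := M.eRk_mono hcl
    rwa [Matroid.eRk_closure_eq] at this
  have h2 : M.eRk (U ∪ ((T \ {p}) \ U)) ≤ M.eRk U + ((T \ {p}) \ U).encard := M.eRk_union_le_eRk_add_encard _ _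
  have h3 : (T \ U).encard = ((T \ {p}) \ U).encard + 1 := by
    have hpTU : p ∈ T \ U := ⟨hpT, hpU⟩
    have : (T \ {p}) \ U = (T \ U) \ {p} := by
      ext u; simp only [mem_sdiff, mem_singleton_iff]; tauto
    rw [this, ← Set.encard_sdiff_singleton_add_one hpTU]
  calc M.eRk (U ∪ T) + 1 ≤ M.eRk U + ((T \ {p}) \ U).encard + 1 := by gcongr; exact h1.trans h2
    _ = M.eRk U + (T \ U).encard := by rw [h3, add_assoc]

/-- The rank of a subset of the ground set is a natural number: `eRk X = (eRk X).toNat`. -/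
theorem coe_toNat_eRk (M : Matroid α) [M.Finite] {X : Set α} (hX : X ⊆ M.E) :
    ((M.eRk X).toNat : ℕ∞) = M.eRk X := by
  have hXfin : X.Finite := M.ground_finite.subset hX
  exact ENat.coe_toNat ((M.eRk_le_encard X).trans_lt hXfin.encard_lt_top).ne

/-- **THE NULLITY STEP** (natural numbers, `rk X := (eRk X).toNat`): adding a circuit `T ⊄ U` raises the nullity by at least
one: `|U| + rk (U ∪ T) + 1 ≤ |U ∪ T| + rk U`. -/
theorem nullity_step (M : Matroid α) [M.Finite] {U T : Set α} (hU : U ⊆ M.E) (hT : M.IsCircuit T)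
    (hnot : ¬ T ⊆ U) :
    U.ncard + (M.eRk (U ∪ T)).toNat + 1 ≤ (U ∪ T).ncard + (M.eRk U).toNat := by
  have hUT : U ∪ T ⊆ M.E := union_subset hU hT.subset_ground
  have hUfin : U.Finite := M.ground_finite.subset hU
  have hTfin : T.Finite := M.ground_finite.subset hT.subset_ground
  have h := eRk_union_circuit_add_one_le M hU hT hnot
  rw [← coe_toNat_eRk M hUT, ← coe_toNat_eRk M hU, ← (hTfin.subset sdiff_subset).cast_ncard_eq] at h
  have h' : (M.eRk (U ∪ T)).toNat + 1 ≤ (M.eRk U).toNat + (T \ U).ncard := by exact_mod_cast h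
  have hcard : (U ∪ T).ncard = U.ncard + (T \ U).ncard := by
    rw [← Set.ncard_union_eq disjoint_sdiff_right hUfin (hTfin.subset sdiff_subset), union_sdiff_self]
  omega

/-- **Private points outside a base set raise its nullity by the size of the family** (relative form of
`eRk_add_card_le_ncard_biUnion`): `rk (U ∪ ⋃S) + #S ≤ rk U + |⋃S ∖ U|`. -/
theorem eRk_union_biUnion_add_card_le (M : Matroid α) [M.Finite] (U : Set α) (hU : U ⊆ M.E)
    (S : Finset (Set α)) (hS : ∀ T ∈ S, M.IsCircuit T)
    (hpriv : ∀ T ∈ S, ∃ p ∈ T, p ∉ U ∧ ∀ T' ∈ S, T' ≠ T → p ∉ T') :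
    M.eRk (U ∪ ⋃ T ∈ S, T) + S.card ≤ M.eRk U + ((⋃ T ∈ S, T) \ U).encard := by
  classical
  induction S using Finset.induction_on with
  | empty => simp
  | @insert T S hTS ih =>
    have hS' : ∀ T' ∈ S, M.IsCircuit T' := fun T' h => hS T' (Finset.mem_insert_of_mem h)
    have hpriv' : ∀ T' ∈ S, ∃ p ∈ T', p ∉ U ∧ ∀ T'' ∈ S, T'' ≠ T' → p ∉ T'' := by
      intro T' h
      obtain ⟨p, hp, hpU, hp'⟩ := hpriv T' (Finset.mem_insert_of_mem h)
      exact ⟨p, hp, hpU, fun T'' h'' hne => hp' T'' (Finset.mem_insert_of_mem h'') hne⟩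
    have ih' := ih hS' hpriv'
    have hT : M.IsCircuit T := hS T (Finset.mem_insert_self T S)
    set V := ⋃ T' ∈ S, T' with hV
    have hVE : V ⊆ M.E := by
      intro t ht
      simp only [hV, mem_iUnion, exists_prop] at ht
      obtain ⟨T', hT', ht⟩ := ht
      exact (hS' T' hT').subset_ground ht
    obtain ⟨p, hpT, hpU, hp⟩ := hpriv T (Finset.mem_insert_self T S)
    have hpV : p ∉ V := by
      intro h
      simp only [hV, mem_iUnion, exists_prop] at h
      obtain ⟨T', hT', hpT'⟩ := h
      exact hp T' (Finset.mem_insert_of_mem hT') (fun h => hTS (h ▸ hT')) hpT'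
    have hnot : ¬ T ⊆ U ∪ V := fun h => by
      rcases h hpT with h | h
      · exact hpU h
      · exact hpV h
    have hstep := eRk_union_circuit_add_one_le M (union_subset hU hVE) hT hnot
    have hunion : U ∪ ⋃ T' ∈ insert T S, T' = (U ∪ V) ∪ T := by
      rw [Finset.set_biUnion_insert]
      ext u; simp only [mem_union, hV]; tauto
    have hdiff : (⋃ T' ∈ insert T S, T') \ U = (V \ U) ∪ (T \ (U ∪ V)) := by
      rw [Finset.set_biUnion_insert]
      ext u; simp only [mem_union, mem_sdiff, hV]; tauto
    have hdisj : Disjoint (V \ U) (T \ (U ∪ V)) := by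
      rw [Set.disjoint_left]
      intro u hu hu'
      exact hu'.2 (Or.inr hu.1)
    rw [hunion, hdiff, Set.encard_union_eq hdisj, Finset.card_insert_of_notMem hTS]
    calc M.eRk (U ∪ V ∪ T) + ((S.card + 1 : ℕ) : ℕ∞)
        = (M.eRk (U ∪ V ∪ T) + 1) + S.card := by push_cast; ring
      _ ≤ (M.eRk (U ∪ V) + (T \ (U ∪ V)).encard) + S.card := by gcongr
      _ = (M.eRk (U ∪ V) + S.card) + (T \ (U ∪ V)).encard := by ring
      _ ≤ (M.eRk U + (V \ U).encard) + (T \ (U ∪ V)).encard := by gcongr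
      _ = M.eRk U + ((V \ U).encard + (T \ (U ∪ V)).encard) := by ring

/-- **The nullity of a subset is at most the nullity of the ground set**: `|X| ≤ rk X + d` when `|E| = rank + d`. -/
theorem ncard_le_eRk_toNat_add_of_subset (M : Matroid α) [M.Finite] {d : ℕ} (hd : M.E.encard = M.eRank + d)
    {X : Set α} (hX : X ⊆ M.E) : X.ncard ≤ (M.eRk X).toNat + d := by
  have hXfin : X.Finite := M.ground_finite.subset hX
  have hEfin : M.E.Finite := M.ground_finite
  have h1 : M.eRank ≤ M.eRk X + (M.E \ X).encard := by
    have := M.eRk_union_le_eRk_add_encard X (M.E \ X)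
    rw [Matroid.eRank_def]
    rwa [union_sdiff_cancel hX] at this
  have h2 : M.E.encard = X.encard + (M.E \ X).encard := by
    rw [← Set.encard_union_eq disjoint_sdiff_right, union_sdiff_cancel hX]
  rw [h2] at hd
  have h3 : X.encard + (M.E \ X).encard ≤ M.eRk X + (M.E \ X).encard + d := by
    rw [hd]; gcongr
  rw [← coe_toNat_eRk M hX, ← hXfin.cast_ncard_eq, ← (hEfin.subset sdiff_subset).cast_ncard_eq] at h3
  have h4 : X.ncard + (M.E \ X).ncard ≤ (M.eRk X).toNat + (M.E \ X).ncard + d := by exact_mod_cast h3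
  omega

open scoped Classical in
/-- **THE BUDGET**: `d` circuits with a private-point choice `priv` (`priv T ∈ T`, `priv T ∉ T'` for `T' ≠ T` in the family) on a
matroid of nullity `d`; for every `C ⊆ E`, with `S₀ := {T : priv T ∈ C}`, the set `C ∪ ⋃ S₀` has nullity at most `#S₀`:
`|C ∪ ⋃ S₀| ≤ rk (C ∪ ⋃ S₀) + #S₀`. -/
theorem ncard_union_filter_le_eRk_add_card (M : Matroid α) [M.Finite] {d : ℕ} (hd : M.E.encard = M.eRank + d)
    (𝒯 : Finset (Set α)) (h𝒯 : ∀ T ∈ 𝒯, M.IsCircuit T) (ht : 𝒯.card = d) (priv : Set α → α)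
    (hpT : ∀ T ∈ 𝒯, priv T ∈ T) (hpN : ∀ T ∈ 𝒯, ∀ T' ∈ 𝒯, T' ≠ T → priv T ∉ T')
    {C : Set α} (hC : C ⊆ M.E) :
    (C ∪ ⋃ T ∈ 𝒯.filter (fun T => priv T ∈ C), T).ncard ≤
      (M.eRk (C ∪ ⋃ T ∈ 𝒯.filter (fun T => priv T ∈ C), T)).toNat + (𝒯.filter (fun T => priv T ∈ C)).card := by
  classical
  set S₀ := 𝒯.filter (fun T => priv T ∈ C) with hS₀
  set R := 𝒯.filter (fun T => priv T ∉ C) with hR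
  set U := C ∪ ⋃ T ∈ S₀, T with hU
  have hUE : U ⊆ M.E := by
    refine union_subset hC ?_
    intro t ht
    simp only [mem_iUnion, exists_prop] at ht
    obtain ⟨T, hT, ht⟩ := ht
    exact (h𝒯 T (Finset.mem_filter.1 hT).1).subset_ground ht
  have hRc : ∀ T ∈ R, M.IsCircuit T := fun T hT => h𝒯 T (Finset.mem_filter.1 hT).1
  have hRp : ∀ T ∈ R, ∃ p ∈ T, p ∉ U ∧ ∀ T' ∈ R, T' ≠ T → p ∉ T' := by
    intro T hT
    have hT𝒯 : T ∈ 𝒯 := (Finset.mem_filter.1 hT).1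
    have hTC : priv T ∉ C := (Finset.mem_filter.1 hT).2
    refine ⟨priv T, hpT T hT𝒯, ?_, fun T' hT' hne => hpN T hT𝒯 T' (Finset.mem_filter.1 hT').1 hne⟩
    intro h
    rcases h with h | h
    · exact hTC h
    · simp only [mem_iUnion, exists_prop] at h
      obtain ⟨T', hT', hpT'⟩ := h
      have hT'𝒯 : T' ∈ 𝒯 := (Finset.mem_filter.1 hT').1
      have hne : T' ≠ T := fun h => hTC (h ▸ (Finset.mem_filter.1 hT').2)
      exact hpN T hT𝒯 T' hT'𝒯 hne hpT'
  have hmain := eRk_union_biUnion_add_card_le M U hUE R hRc hRp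
  set V := ⋃ T ∈ R, T with hV
  have hVE : V ⊆ M.E := by
    intro t ht
    simp only [hV, mem_iUnion, exists_prop] at ht
    obtain ⟨T, hT, ht⟩ := ht
    exact (hRc T hT).subset_ground ht
  have hXE : U ∪ V ⊆ M.E := union_subset hUE hVE
  have hbud := ncard_le_eRk_toNat_add_of_subset M hd hXE
  have hUfin : U.Finite := M.ground_finite.subset hUE
  have hVfin : V.Finite := M.ground_finite.subset hVE
  have hcardX : (U ∪ V).ncard = U.ncard + (V \ U).ncard := by
    rw [← Set.ncard_union_eq disjoint_sdiff_right hUfin (hVfin.subset sdiff_subset), union_sdiff_self]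
  rw [← coe_toNat_eRk M hXE, ← coe_toNat_eRk M hUE, ← (hVfin.subset sdiff_subset).cast_ncard_eq] at hmain
  have hmain' : (M.eRk (U ∪ V)).toNat + R.card ≤ (M.eRk U).toNat + (V \ U).ncard := by exact_mod_cast hmain
  have hsplit : S₀.card + R.card = d := by
    rw [hS₀, hR, Finset.card_filter_add_card_filter_not, ht]
  omega

/-- **Three triangles pairwise sharing distinct points span a six-point set of rank `≤ 3`** — impossible in regime B:
`A`, `B`, `D` distinct triangles, `x ∈ A ∩ D`, `y ∈ B ∩ D`, `x ≠ y`, `A` meets `B`. -/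
theorem six_of_three_triangles (M : Matroid α) [M.Finite]
    (hC1 : ∀ L ⊆ M.E, M.eRk L = 2 → L.ncard ≤ 3)
    (hno : ¬ ∃ W ⊆ M.E, W.ncard = 6 ∧ M.eRk W ≤ 3)
    {A B D : Set α} (hA : M.IsCircuit A) (hA3 : A.ncard = 3) (hB : M.IsCircuit B) (hB3 : B.ncard = 3)
    (hD : M.IsCircuit D) (hD3 : D.ncard = 3) (hAB : A ≠ B) (hAD : A ≠ D) (hBD : B ≠ D)
    {x y : α} (hxA : x ∈ A) (hxD : x ∈ D) (hyB : y ∈ B) (hyD : y ∈ D) (hxy : x ≠ y)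
    (hmeet : ¬ Disjoint A B) : False := by
  have hAfin : A.Finite := M.ground_finite.subset hA.subset_ground
  have hBfin : B.Finite := M.ground_finite.subset hB.subset_ground
  have hDfin : D.Finite := M.ground_finite.subset hD.subset_ground
  obtain ⟨z, hzA, hzB⟩ := Set.not_disjoint_iff.1 hmeet
  have hiDA : D ∩ A = {x} := S2.inter_eq_singleton_of_triangles_through M hC1 hD hD3 hA hA3 (Ne.symm hAD) hxD hxA
  have hiDB : D ∩ B = {y} := S2.inter_eq_singleton_of_triangles_through M hC1 hD hD3 hB hB3 (Ne.symm hBD) hyD hyB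
  have hyA : y ∉ A := by
    intro h
    have : y ∈ D ∩ A := ⟨hyD, h⟩
    rw [hiDA, mem_singleton_iff] at this
    exact hxy this.symm
  have hzy : z ≠ y := fun h => hyA (h ▸ hzA)
  -- rank: `D ⊆ cl {x, y} ⊆ cl (A ∪ B)` and `B ⊆ cl {z, y} ⊆ cl (insert y A)`
  have hDcl : D ⊆ M.closure (A ∪ B) := by
    have h1 : D ⊆ M.closure {x, y} := tri_subset_closure_pair M hD hD3 hxD hyD hxy
    have h2 : ({x, y} : Set α) ⊆ A ∪ B := by
      intro u hu
      rcases hu with rfl | rfl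
      · exact Or.inl hxA
      · exact Or.inr hyB
    exact h1.trans (M.closure_subset_closure h2)
  have hBcl : B ⊆ M.closure (insert y A) := by
    have h1 : B ⊆ M.closure {z, y} := tri_subset_closure_pair M hB hB3 hzB hyB hzy
    have h2 : ({z, y} : Set α) ⊆ insert y A := by
      intro u hu
      rcases hu with rfl | rfl
      · exact Or.inr hzA
      · exact Or.inl rfl
    exact h1.trans (M.closure_subset_closure h2)
  have hrk : M.eRk (A ∪ B ∪ D) ≤ 3 := by
    rw [eRk_union_eq_of_subset_closure M hDcl]
    have h1 : M.eRk (A ∪ B) ≤ M.eRk (insert y A ∪ B) := M.eRk_mono (union_subset_union_left _ (subset_insert _ _))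
    rw [eRk_union_eq_of_subset_closure M hBcl] at h1
    have h2 := M.eRk_insert_le_add_one y A
    rw [eRk_eq_two_of_tri M hA hA3] at h2
    exact h1.trans (h2.trans (by norm_num))
  -- cardinality: `|A ∪ B| = 5` and `D` has exactly one point outside `A ∪ B`
  have hcard : (A ∪ B ∪ D).ncard = 6 := by
    have e1 : (A ∪ B).ncard = 5 := by
      have h := S2.ncard_sdiff_eq_two_of_triangles_meeting M hC1 hA hA3 hB hB3 (Ne.symm hAB) (fun h => hmeet h.symm)
      have hu : A ∪ B = A ∪ (B \ A) := by ext u; simp only [mem_union, mem_sdiff]; tauto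
      rw [hu, Set.ncard_union_eq disjoint_sdiff_right hAfin (hBfin.subset sdiff_subset), hA3, h]
    have e2 : (D \ (A ∪ B)).ncard = 1 := by
      have hi : D ∩ (A ∪ B) = {x, y} := by
        rw [inter_union_distrib_left, hiDA, hiDB]
        ext u; simp only [mem_union, mem_singleton_iff, mem_insert_iff]
      have h := Set.ncard_inter_add_ncard_sdiff_eq_ncard D (A ∪ B) hDfin
      rw [hi, Set.ncard_pair hxy, hD3] at h
      omega
    have hu : A ∪ B ∪ D = (A ∪ B) ∪ (D \ (A ∪ B)) := by ext u; simp only [mem_union, mem_sdiff]; tauto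
    rw [hu, Set.ncard_union_eq disjoint_sdiff_right (hAfin.union hBfin) (hDfin.subset sdiff_subset), e1, e2]
  exact hno ⟨A ∪ B ∪ D, union_subset (union_subset hA.subset_ground hB.subset_ground) hD.subset_ground, hcard, hrk⟩

end S1

end PercRepro
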